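import Literature.Topology.FourManifolds.LatticeFormsEichlerReflections
import Literature.Topology.FourManifolds.LatticeFormsPrimitiveSublatticeDiscriminant
import Literature.Topology.FourManifolds.LatticeFormsDiscriminantFormIsometry
import HarnessLib

/-!
# Special reflections in the stable orthogonal group: `σ_r ∈ Õ(L) ⟺ r² = ±2`
# (Gritsenko–Hulek–Sankaran, *The Kodaira dimension of the moduli of K3 surfaces*, §4 Prop. 4.1 of arXiv:math/0607339)

Trunk T-4MAN vocabulary; sequel of `LatticeFormsStableOrthogonalGroup.lean` / `…Index.lean` (`Õ(L) = {g | ḡ = id}`,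
`[O(L) : Õ(L)] = |O(q_L)|`) and of `LatticeFormsEichlerReflections.lean` (the reflection `normTwoReflectionEquiv`
in a `(±2)`-vector as an isometry). Written for lane `lit-hodgefound` (Track 2 foundations; prover seat
`lit-hodgefound-p18`, gen 39, row g39-#4). THEOREMS ONLY — no definition, no named fact, no instance, no notation:
a reflection `σ_r` (`(r,r) ≠ 0`) is any `g ∈ O(L)` (`B.IsometryEquiv B`) satisfying the integral form of GHS's
formula, `(r,r)·g(l) = (r,r)·l − 2(l,r)·r` for all `l` (so "`r` reflective" = such a `g` exists); "`r` primitive"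
is saturation of `ℤr`; `σ_r ∈ Õ(L)` is `ḡ = id` (`IsometryEquiv.discriminantGroupCongr`, Huybrechts Ch. 14 §2.2).

## Source, verbatim (V. Gritsenko, K. Hulek, G. K. Sankaran, Invent. Math. 169 (2007) 519–567; held text
## `paper:arxiv-math_0607339` p. 14, arXiv numbering "§4 Special reflections in `Õ(L)`")

"Let `L` be an arbitrary nondegenerate integral lattice […] The reflection with respect to the hyperplane defined
by a vector `r` is given by `σ_r : l ↦ l − (2(l,r)/(r,r)) r`. For any `l ∈ L` its divisor `div(l)` in `L` is the
positive generator of the ideal `(l, L)`. In other words `l* = l/div(l)` is a primitive element of the dual lattice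
`L^∨`. If `r` is primitive and the reflection `σ_r` fixes `L`, i.e. `σ_r ∈ O(L)`, then we say that `r` is a
reflective vector. In this case `div(r) | r² | 2 div(r)`.
**Proposition 4.1.** Let `L` be a nondegenerate even integral lattice. Let `r ∈ L` be primitive. Then
`σ_r ∈ Õ(L)` if and only if `r² = ±2`.
*Proof.* For `r* = r/div(r) ∈ L^∨` and `σ_r ∈ Õ(L)` we get `σ_r(r*) = −r* ≡ r* mod L`. Therefore `2r* ∈ L`,
`div(r) = 1` or `2` (because `r` is primitive) and `r² = ±2` or `±4`, because `L` is even. If `r² = ±2` then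
`σ_r ∈ Õ(L)`. If `r² = ±4`, then `div(r) = 2` […] Therefore `r* = r/2 ∈ (L^∨)^∨ = L`. We obtain a contradiction
because `r` is primitive. □"

## Contents (all proved)

* §1 `exists_dual_apply_eq_one_of_primitive`: a primitive `r ≠ 0` of a finitely generated free `ℤ`-module has
  `φ ∈ L^*` with `φ(r) = 1` (Ebeling's extension of functionals from the primitive `ℤr`).
* §2 for a reflection `g = σ_r`: `σ_r(r) = −r`, `(σ_r l, r) = −(l, r)`, `σ_r² = 1`, `σ_r⁻¹ = σ_r`; for `(r,r) = 2ε`: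
  `σ_r(l) = l − ε(l,r) r` and **"if": `discriminantGroupCongr_eq_refl_of_apply_self_eq` (`σ̄_r = id`)**, in
  particular for the tree's `normTwoReflectionEquiv` (`discriminantGroupCongr_normTwoReflectionEquiv`);
  **"only if": `apply_self_eq_two_or_eq_neg_two_of_discriminantGroupCongr_eq_refl`** (`L` nondegenerate even,
  `r` primitive, `σ̄_r = id ⇒ (r,r) = ±2`; the printed argument with `r*` replaced by a functional `φ`,
  `φ(r) = 1`: `σ_r^*φ − φ = (w,·)` forces `(r,r)·w = −2r`, so `(r,r) ∣ 2`), and the **iff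
  `discriminantGroupCongr_reflection_eq_refl_iff`** (Prop. 4.1 as printed).

NOT here: Prop. 4.2 (`−σ_r ∈ Õ(L)`), the divisor `div(r)` and `div(r) | r² | 2div(r)`.

## References

* [GritsenkoHulekSankaran2007Kodaira] V. Gritsenko, K. Hulek, G. K. Sankaran, The Kodaira dimension of the moduli
  of K3 surfaces, Invent. Math. 169 (2007) 519–567 (arXiv:math/0607339): §4 Prop. 4.1 (arXiv numbering).
* [GritsenkoHulekSankaran2007HM] V. Gritsenko, K. Hulek, G. K. Sankaran, The Hirzebruch–Mumford volume for the
  orthogonal group and applications, Doc. Math. 12 (2007) 215–241: §4 proof of Lemma 4.2 ("the reflections `σ_u`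
  and `σ_v` act trivially on the discriminant form").
* [Ebeling1994] W. Ebeling, Lattices and Codes, Vieweg 1994, §1.1 proof of Prop. 1.2.
-/

noncomputable section

open Module Function
open LinearMap (BilinForm)
open LinearMap.BilinForm

namespace Literature.Topology.FourManifolds

universe u

/-! ### §1 A primitive vector has a dual functional: `∃ φ ∈ L^*, φ(r) = 1` -/

section Primitive

variable {M : Type u} [AddCommGroup M] [Module.Finite ℤ M] [Module.Free ℤ M]

/-- **A primitive vector `r` of a finitely generated `ℤ`-module has a functional `φ ∈ L^*` with `φ(r) = 1`**
(GHS: "`l* = l/div(l)` is a primitive element of the dual lattice"; for primitive `r`, the coordinate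
`ℤr → ℤ`, `r ↦ 1`, extends to `L` because `L/ℤr` is torsion free). Primitivity is saturation of `ℤr`.
[cite: GritsenkoHulekSankaran2007Kodaira, §4 (arXiv numbering) ("`l* = l/div(l)` is a primitive element of the dual lattice `L^∨`")] [cite: Ebeling1994, §1.1 proof of Prop. 1.2] -/
theorem exists_dual_apply_eq_one_of_primitive {r : M} (hr0 : r ≠ 0)
    (hsat : ∀ (k : ℤ) (w : M), k ≠ 0 → k • w ∈ ℤ ∙ r → w ∈ ℤ ∙ r) : ∃ φ : Module.Dual ℤ M, φ r = 1 := by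
  obtain ⟨φ, hφ⟩ := exists_dual_comp_subtype_eq_of_forall_smul_mem (ℤ ∙ r) hsat
    ((LinearEquiv.coord ℤ M r hr0 : (ℤ ∙ r) ≃ₗ[ℤ] ℤ) : (ℤ ∙ r) →ₗ[ℤ] ℤ)
  refine ⟨φ, ?_⟩
  have h := LinearMap.congr_fun hφ ⟨r, Submodule.mem_span_singleton_self r⟩
  rw [LinearMap.comp_apply, Submodule.subtype_apply, LinearEquiv.coe_coe, LinearEquiv.coord_self] at h
  exact h

end Primitive

/-! ### §2 Reflections: `σ_r ∈ Õ(L) ⟺ r² = ±2` -/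

section Reflection

variable {M : Type u} [AddCommGroup M] [Module.Free ℤ M] (B : BilinForm ℤ M)

/-- For the reflection `σ_r` (`(r,r)·σ_r(l) = (r,r)·l − 2(l,r)·r`, `(r,r) ≠ 0`): `σ_r(r) = −r`.
[cite: GritsenkoHulekSankaran2007Kodaira, §4 (arXiv numbering) ("`σ_r : l ↦ l − (2(l,r)/(r,r)) r`")] -/
theorem reflection_apply_self {r : M} (hr : B r r ≠ 0) (g : B.IsometryEquiv B)
    (hg : ∀ l, B r r • g l = B r r • l - (2 * B l r) • r) : g r = -r := by
  have h' : B r r • g r = B r r • (-r) := by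
    rw [hg r, ← sub_smul, smul_neg, ← neg_smul]
    congr 1
    ring
  exact smul_right_injective M hr h'

omit [Module.Free ℤ M] in
/-- `(σ_r(l), r) = −(l, r)`. [cite: GritsenkoHulekSankaran2007Kodaira, §4 (arXiv numbering)] -/
theorem apply_reflection_self {r : M} (hr : B r r ≠ 0) (g : B.IsometryEquiv B)
    (hg : ∀ l, B r r • g l = B r r • l - (2 * B l r) • r) (l : M) : B (g l) r = -B l r := by
  have h := congrArg (fun v ↦ B v r) (hg l)
  simp only [map_smul, map_sub, LinearMap.smul_apply, LinearMap.sub_apply, smul_eq_mul] at h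
  have h' : B r r * (B (g l) r + B l r) = 0 := by linear_combination h
  exact eq_neg_of_add_eq_zero_left ((mul_eq_zero.1 h').resolve_left hr)

/-- `σ_r` is an involution: `σ_r(σ_r(l)) = l`. [cite: GritsenkoHulekSankaran2007Kodaira, §4 (arXiv numbering)] -/
theorem reflection_apply_apply {r : M} (hr : B r r ≠ 0) (g : B.IsometryEquiv B)
    (hg : ∀ l, B r r • g l = B r r • l - (2 * B l r) • r) (l : M) : g (g l) = l := by
  have h := hg (g l)
  rw [apply_reflection_self B hr g hg l, hg l] at h
  have h' : B r r • g (g l) = B r r • l := by rw [h]; module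
  exact smul_right_injective M hr h'

/-- `σ_r⁻¹ = σ_r`. [cite: GritsenkoHulekSankaran2007Kodaira, §4 (arXiv numbering)] -/
theorem reflection_symm_apply {r : M} (hr : B r r ≠ 0) (g : B.IsometryEquiv B)
    (hg : ∀ l, B r r • g l = B r r • l - (2 * B l r) • r) (l : M) : (g : M ≃ₗ[ℤ] M).symm l = g l := by
  rw [LinearEquiv.symm_apply_eq]
  exact (reflection_apply_apply B hr g hg l).symm

/-- For `(r,r) = 2ε`, `ε = ±1`: `σ_r(l) = l − ε(l,r)·r`. [cite: GritsenkoHulekSankaran2007Kodaira, §4 (arXiv numbering)] -/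
theorem reflection_apply_of_apply_self_eq {r : M} {ε : ℤ} (hε : ε = 1 ∨ ε = -1) (hr : B r r = 2 * ε)
    (g : B.IsometryEquiv B) (hg : ∀ l, B r r • g l = B r r • l - (2 * B l r) • r) (l : M) :
    g l = l - (ε * B l r) • r := by
  have h2 : (2 * ε : ℤ) ≠ 0 := by rcases hε with rfl | rfl <;> norm_num
  have hεε : ε * ε = 1 := by rcases hε with rfl | rfl <;> norm_num
  have h := hg l
  rw [hr] at h
  refine smul_right_injective M h2 ?_
  change (2 * ε) • g l = (2 * ε) • (l - (ε * B l r) • r)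
  rw [h, smul_sub, smul_smul, show 2 * ε * (ε * B l r) = 2 * B l r by linear_combination (2 * B l r) * hεε]

/-- **"If `r² = ±2` then `σ_r ∈ Õ(L)`"**: for `(r,r) = 2ε` the reflection acts trivially on the discriminant
group, `σ̄_r = id` — for `φ ∈ L^*`: `σ_r^*φ − φ = −ε φ(r)·(r, ·) ∈ i(L)`.
[cite: GritsenkoHulekSankaran2007Kodaira, §4 (arXiv numbering) Prop. 4.1 ("If `r² = ±2` then `σ_r ∈ Õ(L)`")] [cite: GritsenkoHulekSankaran2007HM, §4 proof of Lemma 4.2 ("the reflections `σ_u` and `σ_v` act trivially on the discriminant form")] -/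
theorem discriminantGroupCongr_eq_refl_of_apply_self_eq (hs : B.IsSymm) {r : M} {ε : ℤ} (hε : ε = 1 ∨ ε = -1)
    (hr : B r r = 2 * ε) (g : B.IsometryEquiv B) (hg : ∀ l, B r r • g l = B r r • l - (2 * B l r) • r) :
    g.discriminantGroupCongr = LinearEquiv.refl ℤ B.discriminantGroup := by
  have hr0 : B r r ≠ 0 := by rw [hr]; rcases hε with rfl | rfl <;> norm_num
  refine LinearEquiv.ext fun a ↦ ?_
  obtain ⟨φ, rfl⟩ := B.discriminantGroup_mk_surjective a
  rw [IsometryEquiv.discriminantGroupCongr_mk, LinearEquiv.refl_apply, Submodule.Quotient.eq]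
  refine ⟨(-(ε * φ r)) • r, LinearMap.ext fun l ↦ ?_⟩
  rw [LinearMap.sub_apply, LinearEquiv.dualMap_apply, reflection_symm_apply B hr0 g hg,
    reflection_apply_of_apply_self_eq B hε hr g hg, map_sub, map_smul, map_smul, LinearMap.smul_apply, smul_eq_mul,
    smul_eq_mul, hs.eq r l]
  ring

/-- **The tree's `σ_r` for `(±2)`-vectors acts trivially on `A_L`**: `normTwoReflectionEquiv` of
`LatticeFormsEichlerReflections` (`σ_r v = v − ε(r·v) r`, `r·r = 2ε`) has `σ̄_r = id`, i.e. lies in the stable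
orthogonal group. [cite: GritsenkoHulekSankaran2007Kodaira, §4 (arXiv numbering) Prop. 4.1] [cite: GritsenkoHulekSankaran2007HM, §4 proof of Lemma 4.2] -/
theorem discriminantGroupCongr_normTwoReflectionEquiv (hs : B.IsSymm) (r : M) {ε : ℤ} (hε : ε = 1 ∨ ε = -1)
    (hr : B r r = ε + ε) (hεε : ε * ε = 1) :
    (normTwoReflectionEquiv hs r ε hr hεε).discriminantGroupCongr = LinearEquiv.refl ℤ B.discriminantGroup :=
  discriminantGroupCongr_eq_refl_of_apply_self_eq B hs hε (by rw [hr, two_mul]) _ fun l ↦ by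
    rw [normTwoReflectionEquiv_apply, smul_sub, smul_smul, hr, hs.eq r l,
      show (ε + ε) * (ε * B l r) = 2 * B l r by linear_combination (2 * B l r) * hεε]

variable [Module.Finite ℤ M]

/-- **"If `σ_r ∈ Õ(L)` then `r² = ±2`"** for a nondegenerate even lattice `L` and a primitive reflective `r`:
with `φ ∈ L^*`, `φ(r) = 1` (§1), `σ̄_r = id` gives `σ_r^*φ − φ = (w, ·)` for some `w ∈ L`; evaluating,
`(r,r)·w = −2r`, so primitivity forces `(r,r) ∣ 2` and evenness `(r,r) = ±2` (GHS: "`σ_r(r*) = −r* ≡ r* mod L`.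
Therefore `2r* ∈ L`, `div(r) = 1` or `2` … we obtain a contradiction because `r` is primitive").
[cite: GritsenkoHulekSankaran2007Kodaira, §4 (arXiv numbering) Prop. 4.1] -/
theorem apply_self_eq_two_or_eq_neg_two_of_discriminantGroupCongr_eq_refl (hB : B.Nondegenerate)
    (hs : B.IsSymm) (he : B.IsEven) {r : M} (hr : B r r ≠ 0)
    (hsat : ∀ (k : ℤ) (w : M), k ≠ 0 → k • w ∈ ℤ ∙ r → w ∈ ℤ ∙ r) (g : B.IsometryEquiv B)
    (hg : ∀ l, B r r • g l = B r r • l - (2 * B l r) • r)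
    (hgbar : g.discriminantGroupCongr = LinearEquiv.refl ℤ B.discriminantGroup) : B r r = 2 ∨ B r r = -2 := by
  have hr0 : r ≠ 0 := fun h ↦ hr (by simp [h])
  obtain ⟨φ, hφ⟩ := exists_dual_apply_eq_one_of_primitive hr0 hsat
  have h1 := LinearEquiv.congr_fun hgbar (Submodule.Quotient.mk φ)
  rw [IsometryEquiv.discriminantGroupCongr_mk, LinearEquiv.refl_apply, Submodule.Quotient.eq] at h1
  obtain ⟨w, hw⟩ := h1
  -- `(r,r)·(w, l) = (r,r)·(φ(σ_r l) − φ l) = φ(−2(l,r) r) = −2(l,r)`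
  have key : ∀ l, B (B r r • w + (2 : ℤ) • r) l = 0 := fun l ↦ by
    have h2 := LinearMap.congr_fun hw l
    rw [LinearMap.sub_apply, LinearEquiv.dualMap_apply, reflection_symm_apply B hr g hg] at h2
    have h3 : B r r * B w l = φ (B r r • g l) - B r r * φ l := by rw [map_smul, smul_eq_mul, ← mul_sub, h2]
    rw [hg l, map_sub, map_smul, map_smul, hφ, smul_eq_mul, smul_eq_mul, mul_one] at h3
    rw [map_add, map_smul, map_smul, LinearMap.add_apply, LinearMap.smul_apply, LinearMap.smul_apply, smul_eq_mul,
      smul_eq_mul, h3, hs.eq l r]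
    ring
  have hw0 : B r r • w + (2 : ℤ) • r = 0 := hB.1 _ key
  have hmem : B r r • (-w) ∈ ℤ ∙ r := by
    rw [smul_neg, eq_neg_of_add_eq_zero_left hw0, neg_neg]
    exact Submodule.smul_mem _ _ (Submodule.mem_span_singleton_self r)
  obtain ⟨c, hc⟩ := Submodule.mem_span_singleton.1 (hsat _ _ hr hmem)
  have h2 : (B r r * c) • r = (2 : ℤ) • r := by
    rw [mul_smul, hc, smul_neg, eq_neg_of_add_eq_zero_left hw0, neg_neg]
  have hdvd : B r r ∣ 2 := ⟨c, (smul_left_injective ℤ hr0 h2).symm⟩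
  have hle := Int.le_of_dvd (by norm_num) hdvd
  have hle' := Int.le_of_dvd (by norm_num) ((neg_dvd).2 hdvd)
  obtain ⟨k, hk⟩ := he r
  omega

/-- **GHS, "Special reflections in `Õ(L)`", as printed: let `L` be a nondegenerate even lattice and `r ∈ L`
primitive and reflective (`σ_r ∈ O(L)`); then `σ_r ∈ Õ(L)` if and only if `r² = ±2`.** Here `σ_r` is any
`g ∈ O(L)` with `(r,r)·g(l) = (r,r)·l − 2(l,r)·r` (`(r,r) ≠ 0`), `Õ(L) = {g | ḡ = id}`.
[cite: GritsenkoHulekSankaran2007Kodaira, §4 (arXiv numbering) Prop. 4.1 ("Let `L` be a nondegenerate even integral lattice. Let `r ∈ L` be primitive. Then `σ_r ∈ Õ(L)` if and only if `r² = ±2`.")] -/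
theorem discriminantGroupCongr_reflection_eq_refl_iff (hB : B.Nondegenerate) (hs : B.IsSymm) (he : B.IsEven)
    {r : M} (hr : B r r ≠ 0) (hsat : ∀ (k : ℤ) (w : M), k ≠ 0 → k • w ∈ ℤ ∙ r → w ∈ ℤ ∙ r)
    (g : B.IsometryEquiv B) (hg : ∀ l, B r r • g l = B r r • l - (2 * B l r) • r) :
    g.discriminantGroupCongr = LinearEquiv.refl ℤ B.discriminantGroup ↔ B r r = 2 ∨ B r r = -2 := by
  refine ⟨apply_self_eq_two_or_eq_neg_two_of_discriminantGroupCongr_eq_refl B hB hs he hr hsat g hg, fun h ↦ ?_⟩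
  rcases h with h | h
  · exact discriminantGroupCongr_eq_refl_of_apply_self_eq B hs (ε := 1) (Or.inl rfl) (by rw [h]; norm_num) g hg
  · exact discriminantGroupCongr_eq_refl_of_apply_self_eq B hs (ε := -1) (Or.inr rfl) (by rw [h]; norm_num) g hg

end Reflection

end Literature.Topology.FourManifolds

end
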